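/-
Copyright (c) 2026 the pub-hodgecm-mathlib formalisation cell (harness21).  Prover seat hodgecm-mathlib-K2E3-p14 (g7), Track B «K2-LIT» ∕ h413
(`stmt-HodgeConjecture-24833`), line `K2_E3_EllipticInputs`, leaf (nsc-S-A′) «principal-block standard span», brick E2-J (part F2):
JACQUET MODULES IN STAGES FOR `B ≤ P₂₁ ≤ GL₃(F)` — THE SURJECTION `r_{P₂₁} V ↠ r_B V`, ITS KERNEL, ITS `δ`-BOOKKEEPING, AND THE `GL₂`-JACQUET MODULES OF SUBQUOTIENTS.
2026-09-04.
-/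
import Literature.NumberTheory.Automorphic.JacquetGLFunctor                       -- ★ `jacquetGLMap`, `jacquetGLMap_injective` (left exactness of `r_c`)
import Literature.NumberTheory.Automorphic.ParabolicInductionModulusProofs       -- ★ `jacquetGL_leviProjection_mk`, `rootDeltaChar_eq_rootDeltaChar_leviEmbeddingP`
import Literature.NumberTheory.Automorphic.ParabolicInductionQuotientProofs      -- ★ `Subrepresentation.quotientRep`, `mkQ`
import Literature.RepresentationTheory.FiniteGroups.QuaternionicCharacterEvenMultiplicity     -- ★ `Subrepresentation.comapSubtype`
import Literature.NumberTheory.Automorphic.ParabolicGLReindex                   -- ★ `IsSmooth.comp_of_continuous`, `continuous_reindexGL`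
import Summits.HodgeConjecture.HodgeConjecture.Theorems.K2E3GL3InductionInStagesLevi   -- ★ E2-I∕E2-δ block bookkeeping, `rootDeltaChar_borel_three_eq_mul`
import HarnessLib

/-!
# K2_E3 road (h413), leaf (nsc-S-A′), brick E2-J (part F2) — Jacquet modules in stages `r_B = r_{B_M} ∘ r_{P₂₁}` on `GL₃(F)`

Cell `pub/hodgecm-mathlib` (D-0151), Track B, seat K2E3-p14 (g7); leaf architecture K2E3-p25 (g0) `MEMO-SA-architecture.v1` brick E2, head (E2-J)
`exists_gl2_exponent_decomposition` (K2 bus 2026-09-04 08:40:11Z).  `--supports stmt-HodgeConjecture-24833 --as helper`; THEOREMS ONLY (no definition ∕ instance ∕ notation ∕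
named fact ∕ `sorry`); never imports `Cruxes/…/Lines`.  COUNT-NEUTRAL.

THE MATHEMATICS ([BernsteinZelevinsky1977, Prop. 1.9 (a)(c) «`r_{M,G} = r_{M,L} ∘ r_{L,G}`», §2.3]; [Casselman1995, Prop. 3.2.3, §3.3]; [Zelevinsky1980, §1.2]).  `Q = P₂₁ ≤ GL₃(F)`
(labelling `C = ![false,false,true]`), `M = GL₂ × GL₁`, `ι(g₂) = diag(g₂,1)`, `B ≤ Q` the Borel, `U_B = U_Q ⋊ ι(U₂)`.  For a representation `V` of `GL₃(F)`:
* §1 `U_Q ≤ U_B` gives a linear surjection **`p : r_Q V ↠ r_B V`**, `[x]_Q ↦ [x]_B`, whose KERNEL is exactly the `U₂`-coinvariant kernel of the `GL₂`-restriction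
  `(r_Q V) ∘ ι` (normalised action; `δ_Q^{1∕2}(ι u) = 1` for unipotent `u`): `V(U_B) = V(U_Q) + V(ι U₂)` via the Levi factorisation `u = diag(proj u)·u′`, `u′ ∈ U_Q`
  (★ `leviEmbeddingP_inv_mul_mem_unipotentRadicalP`) — i.e. `r_B V = r_{B₂}((r_Q V) ∘ ι)` as vector spaces;
* §2 `δ`-BOOKKEEPING: for `m` in the Borel Levi `T = LB 3` with image `μ(m) ∈ M`, `p (r_Q V (μ m) w) = δ_{B₂}^{1∕2}(m|_{GL₂}) · r_B V (m) (p w)` (normalised actions; ★ E2-δ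
  `δ_B^{1∕2} = δ_Q^{1∕2} · δ_{B₂}^{1∕2}`);
* §3 LEFT EXACTNESS on subquotients: for `M`-subrepresentations `W₁ ≤ W₂ ≤ r_Q V`, the `U₂`-coinvariants of the `GL₂`-representation `(W₂ ∕ W₁) ∘ ι` are `p(W₂) ∕ p(W₁)`
  (★ `jacquetGLMap_injective` at `n = 2`), by an isomorphism `Θ` with `Θ [[w]] = [p w]`.

HONEST LABEL: HC_CM is proved only modulo the 7 printed citations (2 remaining named inputs: hLiu418 = stmt-HodgeConjecture-24832, h413 =
stmt-HodgeConjecture-24833) until rung 0 closes; count-neutral helper.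

## References
* [BernsteinZelevinsky1977] I. N. Bernstein, A. V. Zelevinsky, Ann. Sci. ÉNS 10 (1977): Prop. 1.9, §2.1, §2.3.
* [Casselman1995] W. Casselman, *Introduction to the theory of admissible representations of p-adic reductive groups* (1995): Prop. 3.2.3, §3.3.
* [Zelevinsky1980] A. V. Zelevinsky, Ann. Sci. ÉNS 13 (1980): §1.2.
-/

set_option autoImplicit false
set_option linter.dupNamespace false

noncomputable section
open scoped MatrixGroups NNReal
namespace Summit.HodgeConjecture.HodgeConjecture.Cruxes.H413.K2E3GL3JacquetInStagesBorel

open Literature.NumberTheory.Automorphic Literature.RepresentationTheory.FiniteGroups Representation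
open K2E3GL3InductionInStagesEmbedding K2E3GL3InductionInStagesLevi

/-! ## §1 The surjection `p : r_Q V ↠ r_B V` and its kernel -/

section Kernel

variable {F : Type*} [Field F] {X : Type*} [AddCommGroup X] [Module ℂ X] (V : Representation ℂ (GL (Fin 3) F) X)

/-- `U_{P₂₁} ≤ U_B` acts trivially on `r_B V`: the quotient map `V → r_B V` is `U_{P₂₁}`-invariant (★ `unipotentRadicalGL_comp_le`). [cite: BernsteinZelevinsky1977, §2.1] -/
theorem mk_comp_restrictUnipotentGL_twoOne_eq :
    ∀ u : ↥(unipotentRadicalP F (![false, false, true] : Fin 3 → Bool)), Representation.Coinvariants.mk (restrictUnipotentGL F (id : Fin 3 → Fin 3) V) ∘ₗ (restrictUnipotentGL F (![false, false, true] : Fin 3 → Bool) V) u =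
      Representation.Coinvariants.mk (restrictUnipotentGL F (id : Fin 3 → Fin 3) V) := by
  intro u
  have hu : ((u : ↥(standardParabolicGL F (![false, false, true] : Fin 3 → Bool))) : GL (Fin 3) F) ∈ unipotentRadicalGL F (id : Fin 3 → Fin 3) :=
    unipotentRadicalGL_comp_le (R := F) (id : Fin 3 → Fin 3) (f := (![false, false, true] : Fin 3 → Bool)) monotone_twoOne ⟨(u : ↥(standardParabolicGL F (![false, false, true] : Fin 3 → Bool))), u.2, rfl⟩
  obtain ⟨u', hu', hu'eq⟩ := hu
  refine LinearMap.ext fun x => ?_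
  rw [LinearMap.comp_apply]
  have : (restrictUnipotentGL F (![false, false, true] : Fin 3 → Bool) V) u x = (restrictUnipotentGL F (id : Fin 3 → Fin 3) V) ⟨u', hu'⟩ x := by
    show V ((u : ↥(standardParabolicGL F (![false, false, true] : Fin 3 → Bool))) : GL (Fin 3) F) x = V ((u' : GL (Fin 3) F)) x
    rw [← hu'eq]; rfl
  rw [this]
  exact Coinvariants.mk_self_apply _ _ _

/-- `p [x]_Q = [x]_B`. [cite: BernsteinZelevinsky1977, Prop. 1.9 (c)] -/
theorem stagesMap_mk (x : X) :
    (Representation.Coinvariants.lift (restrictUnipotentGL F (![false, false, true] : Fin 3 → Bool) V) (Representation.Coinvariants.mk (restrictUnipotentGL F (id : Fin 3 → Fin 3) V)) (K2E3GL3JacquetInStagesBorel.mk_comp_restrictUnipotentGL_twoOne_eq V)) (Representation.Coinvariants.mk (restrictUnipotentGL F (![false, false, true] : Fin 3 → Bool) V) x) = Representation.Coinvariants.mk (restrictUnipotentGL F (id : Fin 3 → Fin 3) V) x :=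
  rfl

/-- `p : r_Q V → r_B V` is surjective. [cite: BernsteinZelevinsky1977, Prop. 1.9 (c)] -/
theorem stagesMap_surjective : Function.Surjective (Representation.Coinvariants.lift (restrictUnipotentGL F (![false, false, true] : Fin 3 → Bool) V) (Representation.Coinvariants.mk (restrictUnipotentGL F (id : Fin 3 → Fin 3) V)) (K2E3GL3JacquetInStagesBorel.mk_comp_restrictUnipotentGL_twoOne_eq V)) := by
  intro a
  obtain ⟨x, rfl⟩ := Coinvariants.mk_surjective _ a
  exact ⟨Coinvariants.mk _ x, rfl⟩

end Kernel

section KernelTwo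

variable {F : Type*} [Field F] [ValuativeRel F] [TopologicalSpace F] [IsNonarchimedeanLocalField F]
  (e : Fin 2 ≃ {i : Fin 3 // (![false, false, true] : Fin 3 → Bool) i = false})
  (he : ∀ j : Fin 2, ((e j : {i : Fin 3 // (![false, false, true] : Fin 3 → Bool) i = false}) : Fin 3) = Fin.castSucc j)
  {X : Type*} [AddCommGroup X] [Module ℂ X] (V : Representation ℂ (GL (Fin 3) F) X)

omit [ValuativeRel F] [TopologicalSpace F] [IsNonarchimedeanLocalField F] in
include he in
/-- `ι(U₂) ≤ U_B`: for an upper unitriangular `k ∈ GL₂`, `diag(k, 1)` is upper unitriangular in `GL₃`. [cite: BernsteinZelevinsky1977, §2.1] -/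
theorem blockDiagonalGL_mulSingle_false_mem_unipotentRadicalGL (k : GL (Fin 2) F) (hk : k ∈ unipotentRadicalGL F (id : Fin 2 → Fin 2)) :
    blockDiagonalGL F (![false, false, true] : Fin 3 → Bool) (Pi.mulSingle (M := (fun a : Bool => GL {i : Fin 3 // (![false, false, true] : Fin 3 → Bool) i = a} F)) false (reindexGL e k)) ∈ unipotentRadicalGL F (id : Fin 3 → Fin 3) := by
  rw [mem_unipotentRadicalGL_iff_entry] at hk ⊢
  obtain ⟨hbt, hdiag⟩ := hk
  rw [← coe_leviEmbeddingP]
  have hlast : (Fin.last 2 : Fin 3) = 2 := rfl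
  refine ⟨fun i j hij => ?_, fun i j hij => ?_⟩
  · induction i using Fin.lastCases with
    | last =>
      induction j using Fin.lastCases with
      | last => exact absurd hij (lt_irrefl _)
      | cast j => rw [hlast, blockEmbedding_apply_two_castSucc]
    | cast i =>
      induction j using Fin.lastCases with
      | last => exact absurd (Fin.castSucc_lt_last i) (not_lt.2 (le_of_lt hij))
      | cast j => rw [blockEmbedding_apply_castSucc e he]; exact hbt (Fin.castSucc_lt_castSucc_iff.1 hij)
  · obtain rfl : i = j := hij
    induction i using Fin.lastCases with
    | last => rw [hlast, blockEmbedding_apply_two_two, Matrix.one_apply_eq]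
    | cast i => rw [blockEmbedding_apply_castSucc e he, hdiag i i rfl, Matrix.one_apply_eq, Matrix.one_apply_eq]

omit [ValuativeRel F] [TopologicalSpace F] [IsNonarchimedeanLocalField F] in
/-- An upper unitriangular `2 × 2` matrix has determinant `1`. [folklore] -/
theorem det_eq_one_of_mem_unipotentRadicalGL_two (k : GL (Fin 2) F) (hk : k ∈ unipotentRadicalGL F (id : Fin 2 → Fin 2)) :
    Matrix.GeneralLinearGroup.det k = 1 := by
  rw [mem_unipotentRadicalGL_iff_entry] at hk
  obtain ⟨hbt, hdiag⟩ := hk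
  ext
  rw [Matrix.GeneralLinearGroup.val_det_apply, Matrix.det_fin_two, hdiag 0 0 rfl, hdiag 1 1 rfl, hbt (show (id 0 : Fin 2) < id 1 by decide),
    Matrix.one_apply_eq, Matrix.one_apply_eq, Units.val_one]
  ring

/-- `δ_{P₂₁}^{1∕2}(ι k) = 1` for `k` upper unitriangular (`‖det k‖ = 1`, ★ `rootDeltaChar_standardParabolicGL_bool`). [cite: BernsteinZelevinsky1977, 1.7 and §2.3] -/
theorem rootDeltaChar_blockEmbedding_eq_one_of_mem_unipotentRadicalGL (k : GL (Fin 2) F) (hk : k ∈ unipotentRadicalGL F (id : Fin 2 → Fin 2)) :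
    rootDeltaChar (standardParabolicGL F (![false, false, true] : Fin 3 → Bool)) (leviEmbeddingP F (![false, false, true] : Fin 3 → Bool) (Pi.mulSingle (M := (fun a : Bool => GL {i : Fin 3 // (![false, false, true] : Fin 3 → Bool) i = a} F)) false (reindexGL e k))) = 1 := by
  haveI : IsTopologicalRing F := inferInstance
  apply Units.ext
  rw [rootDeltaChar_standardParabolicGL_bool, leviProjection_leviEmbeddingP_apply, Pi.mulSingle_eq_same,
    Pi.mulSingle_eq_of_ne (show true ≠ false by decide), map_one, Units.val_one, map_one, one_pow, inv_one, mul_one,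
    Matrix.GeneralLinearGroup.val_det_apply, coe_reindexGL, Matrix.det_reindex_self, ← Matrix.GeneralLinearGroup.val_det_apply,
    det_eq_one_of_mem_unipotentRadicalGL_two k hk, Units.val_one, map_one, one_pow, NNReal.sqrt_one, NNReal.coe_one, Complex.ofReal_one, Units.val_one]

/-- The NORMALISED action of `ι k`, `k` upper unitriangular, on `r_Q V`: `r_Q V (ι k) [x] = [V(diag(k,1)) x]` (no `δ`). [cite: BernsteinZelevinsky1977, §1.8] -/
theorem normalizedJacquetGL_blockEmbedding_mk_of_mem_unipotentRadicalGL (k : GL (Fin 2) F) (hk : k ∈ unipotentRadicalGL F (id : Fin 2 → Fin 2)) (x : X) :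
    (normalizedJacquetGL F (![false, false, true] : Fin 3 → Bool) V) (Pi.mulSingle (M := (fun a : Bool => GL {i : Fin 3 // (![false, false, true] : Fin 3 → Bool) i = a} F)) false (reindexGL e k)) (Representation.Coinvariants.mk (restrictUnipotentGL F (![false, false, true] : Fin 3 → Bool) V) x) =
      Representation.Coinvariants.mk (restrictUnipotentGL F (![false, false, true] : Fin 3 → Bool) V) (V (blockDiagonalGL F (![false, false, true] : Fin 3 → Bool) (Pi.mulSingle (M := (fun a : Bool => GL {i : Fin 3 // (![false, false, true] : Fin 3 → Bool) i = a} F)) false (reindexGL e k))) x) := by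
  rw [normalizedJacquetGL_mk, rootDeltaChar_blockEmbedding_eq_one_of_mem_unipotentRadicalGL e k hk, inv_one, Units.val_one, one_smul]

omit [ValuativeRel F] [TopologicalSpace F] [IsNonarchimedeanLocalField F] in
include he in
/-- The `GL₂`-block of `u ∈ U_B` is upper unitriangular. [cite: BernsteinZelevinsky1977, §2.1] -/
theorem reindexGL_symm_leviProjection_mem_unipotentRadicalGL (u : ↥(unipotentRadicalP F (id : Fin 3 → Fin 3))) :
    (reindexGL e).symm (leviProjection F (![false, false, true] : Fin 3 → Bool) ⟨((u : ↥(standardParabolicGL F (id : Fin 3 → Fin 3))) : GL (Fin 3) F),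
        borel_le_standardParabolicGL monotone_twoOne (u : ↥(standardParabolicGL F (id : Fin 3 → Fin 3))).2⟩ false) ∈
      unipotentRadicalGL F (id : Fin 2 → Fin 2) := by
  have hu : ((u : ↥(standardParabolicGL F (id : Fin 3 → Fin 3))) : GL (Fin 3) F) ∈ unipotentRadicalGL F (id : Fin 3 → Fin 3) :=
    ⟨(u : ↥(standardParabolicGL F (id : Fin 3 → Fin 3))), u.2, rfl⟩
  rw [mem_unipotentRadicalGL_iff_entry] at hu ⊢
  obtain ⟨hbt, hdiag⟩ := hu
  refine ⟨fun i j hij => ?_, fun i j hij => ?_⟩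
  · rw [reindex_block_apply e he]; exact hbt (Fin.castSucc_lt_castSucc_iff.2 hij)
  · obtain rfl : i = j := hij
    rw [reindex_block_apply e he, hdiag _ _ rfl, Matrix.one_apply_eq, Matrix.one_apply_eq]

omit [ValuativeRel F] [TopologicalSpace F] [IsNonarchimedeanLocalField F] in
/-- The `GL₁`-block of `u ∈ U_B` is `1`. [cite: BernsteinZelevinsky1977, §2.1] -/
theorem leviProjection_true_eq_one (u : ↥(unipotentRadicalP F (id : Fin 3 → Fin 3))) :
    leviProjection F (![false, false, true] : Fin 3 → Bool) ⟨((u : ↥(standardParabolicGL F (id : Fin 3 → Fin 3))) : GL (Fin 3) F),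
        borel_le_standardParabolicGL monotone_twoOne (u : ↥(standardParabolicGL F (id : Fin 3 → Fin 3))).2⟩ true = 1 := by
  have hu : ((u : ↥(standardParabolicGL F (id : Fin 3 → Fin 3))) : GL (Fin 3) F) ∈ unipotentRadicalGL F (id : Fin 3 → Fin 3) :=
    ⟨(u : ↥(standardParabolicGL F (id : Fin 3 → Fin 3))), u.2, rfl⟩
  rw [mem_unipotentRadicalGL_iff_entry] at hu
  haveI := subsingleton_block_true
  ext i j
  obtain rfl : i = j := Subsingleton.elim i j
  have hi : i = ⟨2, rfl⟩ := Subsingleton.elim _ _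
  subst hi
  rw [leviProjection_apply_coe, Units.val_one, Matrix.one_apply_eq]
  exact (hu.2 2 2 rfl).trans (Matrix.one_apply_eq 2)

set_option maxHeartbeats 400000 in
include he in
/-- **THE KERNEL OF `p : r_Q V ↠ r_B V` IS THE `U₂`-COINVARIANT KERNEL OF THE `GL₂`-RESTRICTION `(r_Q V) ∘ ι`** (normalised action), i.e. `r_B V = r_{B₂}((r_Q V)∘ι)` as
vector spaces: `⊇` since `ι(U₂) ≤ U_B` and `δ_Q^{1∕2}(ι u) = 1`; `⊆` by the Levi factorisation `u = diag(proj u) · u′` (`u′ ∈ U_Q`) of `u ∈ U_B ≤ P₂₁`, whose Levi part is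
`ι(k)` with `k ∈ U₂`: `V(u)y − y = diag(V(u′)y − y) + (ι(k)·y − y)`. [cite: BernsteinZelevinsky1977, Prop. 1.9 (c)] [cite: Casselman1995, Prop. 3.2.3] -/
theorem ker_stagesMap_eq : LinearMap.ker (Representation.Coinvariants.lift (restrictUnipotentGL F (![false, false, true] : Fin 3 → Bool) V) (Representation.Coinvariants.mk (restrictUnipotentGL F (id : Fin 3 → Fin 3) V)) (K2E3GL3JacquetInStagesBorel.mk_comp_restrictUnipotentGL_twoOne_eq V)) = (Representation.Coinvariants.ker (restrictUnipotentGL F (id : Fin 2 → Fin 2) ((normalizedJacquetGL F (![false, false, true] : Fin 3 → Bool) V).comp ((MonoidHom.mulSingle (fun a : Bool => GL {i : Fin 3 // (![false, false, true] : Fin 3 → Bool) i = a} F) false).comp (reindexGL e).toMonoidHom) : Representation ℂ (GL (Fin 2) F) (restrictUnipotentGL F (![false, false, true] : Fin 3 → Bool) V).Coinvariants))) := by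
  apply le_antisymm
  · intro w hw
    obtain ⟨x, rfl⟩ := Coinvariants.mk_surjective _ w
    rw [LinearMap.mem_ker, stagesMap_mk, Coinvariants.mk_eq_zero] at hw
    refine Submodule.span_induction (p := fun y _ => Representation.Coinvariants.mk (restrictUnipotentGL F (![false, false, true] : Fin 3 → Bool) V) y ∈ (Representation.Coinvariants.ker (restrictUnipotentGL F (id : Fin 2 → Fin 2) ((normalizedJacquetGL F (![false, false, true] : Fin 3 → Bool) V).comp ((MonoidHom.mulSingle (fun a : Bool => GL {i : Fin 3 // (![false, false, true] : Fin 3 → Bool) i = a} F) false).comp (reindexGL e).toMonoidHom) : Representation ℂ (GL (Fin 2) F) (restrictUnipotentGL F (![false, false, true] : Fin 3 → Bool) V).Coinvariants)))) ?_ ?_ ?_ ?_ hw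
    · rintro _ ⟨⟨u, y⟩, rfl⟩
      dsimp only
      -- Levi factorisation of `u ∈ U_B ≤ P₂₁`
      set q : ↥(standardParabolicGL F (![false, false, true] : Fin 3 → Bool)) := ⟨((u : ↥(standardParabolicGL F (id : Fin 3 → Fin 3))) : GL (Fin 3) F),
        borel_le_standardParabolicGL monotone_twoOne (u : ↥(standardParabolicGL F (id : Fin 3 → Fin 3))).2⟩ with hq
      set n : (Π a : Bool, GL {i : Fin 3 // (![false, false, true] : Fin 3 → Bool) i = a} F) := leviProjection F (![false, false, true] : Fin 3 → Bool) q with hn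
      set k : GL (Fin 2) F := (reindexGL e).symm (n false) with hkdef
      have hk : k ∈ unipotentRadicalGL F (id : Fin 2 → Fin 2) := reindexGL_symm_leviProjection_mem_unipotentRadicalGL e he u
      obtain ⟨k', hk', hk'eq⟩ := hk
      have hnk : n = Pi.mulSingle (M := (fun a : Bool => GL {i : Fin 3 // (![false, false, true] : Fin 3 → Bool) i = a} F)) false (reindexGL e k) := by
        rw [← mulSingle_false_mul_mulSingle_true n, hn, leviProjection_true_eq_one u, Pi.mulSingle_one, mul_one, hkdef, MulEquiv.apply_symm_apply]
      have hu' : (leviEmbeddingP F (![false, false, true] : Fin 3 → Bool) n)⁻¹ * q ∈ unipotentRadicalP F (![false, false, true] : Fin 3 → Bool) := leviEmbeddingP_inv_mul_mem_unipotentRadicalP q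
      have hVu : (restrictUnipotentGL F (id : Fin 3 → Fin 3) V) u y = V (blockDiagonalGL F (![false, false, true] : Fin 3 → Bool) n) (V (((leviEmbeddingP F (![false, false, true] : Fin 3 → Bool) n)⁻¹ * q : ↥(standardParabolicGL F (![false, false, true] : Fin 3 → Bool))) : GL (Fin 3) F) y) := by
        rw [← Module.End.mul_apply, ← map_mul, ← coe_leviEmbeddingP, ← Subgroup.coe_mul, mul_inv_cancel_left]; rfl
      have hsplit : (restrictUnipotentGL F (id : Fin 3 → Fin 3) V) u y - y =
          V (blockDiagonalGL F (![false, false, true] : Fin 3 → Bool) n) ((restrictUnipotentGL F (![false, false, true] : Fin 3 → Bool) V) ⟨_, hu'⟩ y - y) + (V (blockDiagonalGL F (![false, false, true] : Fin 3 → Bool) n) y - y) := by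
        rw [hVu, map_sub]; exact (sub_add_sub_cancel _ _ _).symm
      rw [hsplit, map_add, ← jacquetGL_mk, map_sub (Representation.Coinvariants.mk (restrictUnipotentGL F (![false, false, true] : Fin 3 → Bool) V)) ((restrictUnipotentGL F (![false, false, true] : Fin 3 → Bool) V) _ y) y,
        Coinvariants.mk_self_apply, sub_self, map_zero, zero_add, map_sub, ← jacquetGL_mk]
      -- `r_Q(n)[y] - [y]` with `n = ι k`, `k ∈ U₂`
      have hJ : jacquetGL F (![false, false, true] : Fin 3 → Bool) V n (Representation.Coinvariants.mk (restrictUnipotentGL F (![false, false, true] : Fin 3 → Bool) V) y) =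
          (normalizedJacquetGL F (![false, false, true] : Fin 3 → Bool) V) n (Representation.Coinvariants.mk (restrictUnipotentGL F (![false, false, true] : Fin 3 → Bool) V) y) := by
        rw [jacquetGL_mk, hnk, normalizedJacquetGL_blockEmbedding_mk_of_mem_unipotentRadicalGL e V k ⟨k', hk', hk'eq⟩]
      rw [hJ, hnk, ← hk'eq]
      exact Coinvariants.sub_mem_ker (ρ := restrictUnipotentGL F (id : Fin 2 → Fin 2) ((normalizedJacquetGL F (![false, false, true] : Fin 3 → Bool) V).comp ((MonoidHom.mulSingle (fun a : Bool => GL {i : Fin 3 // (![false, false, true] : Fin 3 → Bool) i = a} F) false).comp (reindexGL e).toMonoidHom) : Representation ℂ (GL (Fin 2) F) (restrictUnipotentGL F (![false, false, true] : Fin 3 → Bool) V).Coinvariants)) ⟨k', hk'⟩ _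
    · rw [map_zero]; exact Submodule.zero_mem _
    · intro a b _ _ ha hb; rw [map_add]; exact Submodule.add_mem _ ha hb
    · intro a y _ hy; rw [map_smul]; exact Submodule.smul_mem _ a hy
  · refine Submodule.span_le.2 ?_
    rintro _ ⟨⟨u, w⟩, rfl⟩
    rw [SetLike.mem_coe, LinearMap.mem_ker, map_sub, sub_eq_zero]
    obtain ⟨x, rfl⟩ := Coinvariants.mk_surjective _ w
    have hu : ((u : ↥(standardParabolicGL F (id : Fin 2 → Fin 2))) : GL (Fin 2) F) ∈ unipotentRadicalGL F (id : Fin 2 → Fin 2) :=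
      ⟨(u : ↥(standardParabolicGL F (id : Fin 2 → Fin 2))), u.2, rfl⟩
    show (Representation.Coinvariants.lift (restrictUnipotentGL F (![false, false, true] : Fin 3 → Bool) V) (Representation.Coinvariants.mk (restrictUnipotentGL F (id : Fin 3 → Fin 3) V)) (K2E3GL3JacquetInStagesBorel.mk_comp_restrictUnipotentGL_twoOne_eq V)) ((normalizedJacquetGL F (![false, false, true] : Fin 3 → Bool) V) (Pi.mulSingle (M := (fun a : Bool => GL {i : Fin 3 // (![false, false, true] : Fin 3 → Bool) i = a} F)) false (reindexGL e ((u : ↥(standardParabolicGL F (id : Fin 2 → Fin 2))) : GL (Fin 2) F)))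
      (Representation.Coinvariants.mk (restrictUnipotentGL F (![false, false, true] : Fin 3 → Bool) V) x)) = _
    obtain ⟨u₃, hu₃, hu₃eq⟩ := blockDiagonalGL_mulSingle_false_mem_unipotentRadicalGL e he _ hu
    rw [normalizedJacquetGL_blockEmbedding_mk_of_mem_unipotentRadicalGL e V _ hu, stagesMap_mk, stagesMap_mk, ← hu₃eq]
    exact Coinvariants.mk_self_apply (restrictUnipotentGL F (id : Fin 3 → Fin 3) V) ⟨u₃, hu₃⟩ x

end KernelTwo

/-! ## §2 `δ`-bookkeeping: `p` intertwines `r_Q V ∘ μ`, up to `δ_{B₂}^{1∕2}`, with `r_B V` -/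

section Delta

variable {F : Type*} [Field F] [ValuativeRel F] [TopologicalSpace F] [IsNonarchimedeanLocalField F]
  (e : Fin 2 ≃ {i : Fin 3 // (![false, false, true] : Fin 3 → Bool) i = false})
  (he : ∀ j : Fin 2, ((e j : {i : Fin 3 // (![false, false, true] : Fin 3 → Bool) i = false}) : Fin 3) = Fin.castSucc j)
  {X : Type*} [AddCommGroup X] [Module ℂ X] (V : Representation ℂ (GL (Fin 3) F) X)

include he in
/-- **`δ`-BOOKKEEPING FOR JACQUET MODULES IN STAGES.**  For `m` in the Borel Levi `T` (diagonal torus) with image `μ(m) = proj_{P₂₁}(diag m)` in `M = GL₂ × GL₁`: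
`p (r_Q V (μ m) w) = δ_{B₂}^{1∕2}(m|_{GL₂}) · r_B V (m) (p w)` for the NORMALISED actions ★ `normalizedJacquetGL` (`δ_B^{1∕2} = δ_Q^{1∕2}·δ_{B₂}^{1∕2}`, ★ E2-δ
`rootDeltaChar_borel_three_eq_mul`).  Hence `p` is `T`-equivariant from `(r_Q V ∘ μ) ⊗ δ_{B₂}^{-1∕2}` — i.e. from the NORMALISED `B₂`-Jacquet action of `(r_Q V)∘ι`
tensored with the `GL₁`-block — to `r_B V`. [cite: BernsteinZelevinsky1977, Prop. 1.9 (c)] [cite: Casselman1995, §3.3] -/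
theorem stagesMap_normalizedJacquetGL_levi (m : (Π a : Fin 3, GL {i : Fin 3 // (id : Fin 3 → Fin 3) i = a} F)) (w : (restrictUnipotentGL F (![false, false, true] : Fin 3 → Bool) V).Coinvariants) :
    (Representation.Coinvariants.lift (restrictUnipotentGL F (![false, false, true] : Fin 3 → Bool) V) (Representation.Coinvariants.mk (restrictUnipotentGL F (id : Fin 3 → Fin 3) V)) (K2E3GL3JacquetInStagesBorel.mk_comp_restrictUnipotentGL_twoOne_eq V)) ((normalizedJacquetGL F (![false, false, true] : Fin 3 → Bool) V) (((leviProjection F (![false, false, true] : Fin 3 → Bool)).comp ((Subgroup.inclusion (borel_le_standardParabolicGL K2E3GL3InductionInStagesEmbedding.monotone_twoOne)).comp (leviEmbeddingP F (id : Fin 3 → Fin 3)))) m) w) =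
      ((rootDeltaChar (standardParabolicGL F (id : Fin 2 → Fin 2)) ⟨(reindexGL e).symm (leviProjection F (![false, false, true] : Fin 3 → Bool)
          ⟨(leviEmbeddingP F (id : Fin 3 → Fin 3) m : GL (Fin 3) F), borel_le_standardParabolicGL monotone_twoOne (leviEmbeddingP F (id : Fin 3 → Fin 3) m).2⟩ false),
          reindex_block_mem_borel_two e he (leviEmbeddingP F (id : Fin 3 → Fin 3) m)⟩ : ℂˣ) : ℂ) • (normalizedJacquetGL F (id : Fin 3 → Fin 3) V) m ((Representation.Coinvariants.lift (restrictUnipotentGL F (![false, false, true] : Fin 3 → Bool) V) (Representation.Coinvariants.mk (restrictUnipotentGL F (id : Fin 3 → Fin 3) V)) (K2E3GL3JacquetInStagesBorel.mk_comp_restrictUnipotentGL_twoOne_eq V)) w) := by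
  haveI : IsTopologicalRing F := inferInstance
  obtain ⟨x, rfl⟩ := Coinvariants.mk_surjective _ w
  set q : ↥(standardParabolicGL F (![false, false, true] : Fin 3 → Bool)) := ⟨(leviEmbeddingP F (id : Fin 3 → Fin 3) m : GL (Fin 3) F),
    borel_le_standardParabolicGL monotone_twoOne (leviEmbeddingP F (id : Fin 3 → Fin 3) m).2⟩ with hq
  have hE := rootDeltaChar_borel_three_eq_mul e he (leviEmbeddingP F (id : Fin 3 → Fin 3) m)
  -- the left-hand side: `r_Q V (proj q) [x] = δ_Q^{1/2}(q)⁻¹ • [V q x]`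
  have hL : (normalizedJacquetGL F (![false, false, true] : Fin 3 → Bool) V) (((leviProjection F (![false, false, true] : Fin 3 → Bool)).comp ((Subgroup.inclusion (borel_le_standardParabolicGL K2E3GL3InductionInStagesEmbedding.monotone_twoOne)).comp (leviEmbeddingP F (id : Fin 3 → Fin 3)))) m) (Representation.Coinvariants.mk (restrictUnipotentGL F (![false, false, true] : Fin 3 → Bool) V) x) =
      (((rootDeltaChar (standardParabolicGL F (![false, false, true] : Fin 3 → Bool)) q)⁻¹ : ℂˣ) : ℂ) • Representation.Coinvariants.mk (restrictUnipotentGL F (![false, false, true] : Fin 3 → Bool) V) (V (q : GL (Fin 3) F) x) := by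
    have h1 : (normalizedJacquetGL F (![false, false, true] : Fin 3 → Bool) V) (((leviProjection F (![false, false, true] : Fin 3 → Bool)).comp ((Subgroup.inclusion (borel_le_standardParabolicGL K2E3GL3InductionInStagesEmbedding.monotone_twoOne)).comp (leviEmbeddingP F (id : Fin 3 → Fin 3)))) m) (Representation.Coinvariants.mk (restrictUnipotentGL F (![false, false, true] : Fin 3 → Bool) V) x) =
        (((((rootDeltaChar (standardParabolicGL F (![false, false, true] : Fin 3 → Bool))).comp (leviEmbeddingP F (![false, false, true] : Fin 3 → Bool)))⁻¹ (leviProjection F (![false, false, true] : Fin 3 → Bool) q) : ℂˣ) : ℂ)) •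
          jacquetGL F (![false, false, true] : Fin 3 → Bool) V (leviProjection F (![false, false, true] : Fin 3 → Bool) q) (Representation.Coinvariants.mk (restrictUnipotentGL F (![false, false, true] : Fin 3 → Bool) V) x) := rfl
    rw [h1, jacquetGL_leviProjection_mk, MonoidHom.inv_apply, MonoidHom.comp_apply, ← rootDeltaChar_eq_rootDeltaChar_leviEmbeddingP]
  rw [hL, map_smul, stagesMap_mk, stagesMap_mk, normalizedJacquetGL_mk, smul_smul]
  congr 1
  rw [Units.val_inv_eq_inv_val, Units.val_inv_eq_inv_val, hE, mul_inv, mul_comm (((rootDeltaChar (standardParabolicGL F (![false, false, true] : Fin 3 → Bool)) q : ℂˣ) : ℂ))⁻¹, ← mul_assoc,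
    mul_inv_cancel₀ (Units.ne_zero _), one_mul]

end Delta

/-! ## §3 The `GL₂`-Jacquet modules of subquotients of `r_Q V` -/

section Subquotient

variable {F : Type} [Field F] [ValuativeRel F] [TopologicalSpace F] [IsNonarchimedeanLocalField F]
  (e : Fin 2 ≃ {i : Fin 3 // (![false, false, true] : Fin 3 → Bool) i = false})
  (he : ∀ j : Fin 2, ((e j : {i : Fin 3 // (![false, false, true] : Fin 3 → Bool) i = false}) : Fin 3) = Fin.castSucc j)
  {X : Type*} [AddCommGroup X] [Module ℂ X] (V : Representation ℂ (GL (Fin 3) F) X)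

include he in
/-- **LEFT EXACTNESS IN THE `GL₂`-SLOT: the `U₂`-kernel of an `M`-subrepresentation `W₂ ≤ r_Q V` is `W₂ ∩ ker p`** (★ `jacquetGLMap_injective` at `n = 2` for the
`GL₂`-restrictions + §1). [cite: BernsteinZelevinsky1977, Prop. 1.9 (a)] -/
theorem mem_coinvariantsKer_subrepresentation_iff (hW : (normalizedJacquetGL F (![false, false, true] : Fin 3 → Bool) V).IsSmooth) (W₂ : Subrepresentation (normalizedJacquetGL F (![false, false, true] : Fin 3 → Bool) V)) (y : ↥W₂.toSubmodule) :
    y ∈ Representation.Coinvariants.ker (restrictUnipotentGL F (id : Fin 2 → Fin 2) (W₂.toRepresentation.comp ((MonoidHom.mulSingle (fun a : Bool => GL {i : Fin 3 // (![false, false, true] : Fin 3 → Bool) i = a} F) false).comp (reindexGL e).toMonoidHom) : Representation ℂ (GL (Fin 2) F) ↥W₂.toSubmodule)) ↔ (Representation.Coinvariants.lift (restrictUnipotentGL F (![false, false, true] : Fin 3 → Bool) V) (Representation.Coinvariants.mk (restrictUnipotentGL F (id : Fin 3 → Fin 3) V)) (K2E3GL3JacquetInStagesBorel.mk_comp_restrictUnipotentGL_twoOne_eq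 V)) (y : (restrictUnipotentGL F (![false, false, true] : Fin 3 → Bool) V).Coinvariants) = 0 := by
  haveI : IsTopologicalRing F := inferInstance
  have hcont : Continuous (((MonoidHom.mulSingle (fun a : Bool => GL {i : Fin 3 // (![false, false, true] : Fin 3 → Bool) i = a} F) false).comp (reindexGL e).toMonoidHom) : GL (Fin 2) F → (Π a : Bool, GL {i : Fin 3 // (![false, false, true] : Fin 3 → Bool) i = a} F)) := (_root_.continuous_mulSingle false).comp (continuous_reindexGL e)
  have hsm : Representation.IsSmooth ((normalizedJacquetGL F (![false, false, true] : Fin 3 → Bool) V).comp ((MonoidHom.mulSingle (fun a : Bool => GL {i : Fin 3 // (![false, false, true] : Fin 3 → Bool) i = a} F) false).comp (reindexGL e).toMonoidHom) : Representation ℂ (GL (Fin 2) F) (restrictUnipotentGL F (![false, false, true] : Fin 3 → Bool) V).Coinvariants) := IsSmooth.comp_of_continuous _ _ hcont hW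
  let f : Representation.IntertwiningMap (W₂.toRepresentation.comp ((MonoidHom.mulSingle (fun a : Bool => GL {i : Fin 3 // (![false, false, true] : Fin 3 → Bool) i = a} F) false).comp (reindexGL e).toMonoidHom) : Representation ℂ (GL (Fin 2) F) ↥W₂.toSubmodule) ((normalizedJacquetGL F (![false, false, true] : Fin 3 → Bool) V).comp ((MonoidHom.mulSingle (fun a : Bool => GL {i : Fin 3 // (![false, false, true] : Fin 3 → Bool) i = a} F) false).comp (reindexGL e).toMonoidHom) : Representation ℂ (GL (Fin 2) F) (restrictUnipotentGL F (![false, false, true] : Fin 3 → Bool) V).Coinvariants) :=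
    { toLinearMap := W₂.toSubmodule.subtype, isIntertwining' := fun g => LinearMap.ext fun v => rfl }
  have hfinj : Function.Injective f := fun a b hab => Subtype.ext hab
  have hinj := jacquetGLMap_injective (F := F) (c := (id : Fin 2 → Fin 2)) monotone_id hsm f hfinj
  -- `r(f) [y] = [f y] = [↑y]` (no rewriting inside `r(f)`-terms: definitional unfolding of the two representations is expensive)
  have hmk : jacquetGLMap F (id : Fin 2 → Fin 2) f (Representation.Coinvariants.mk (restrictUnipotentGL F (id : Fin 2 → Fin 2) (W₂.toRepresentation.comp ((MonoidHom.mulSingle (fun a : Bool => GL {i : Fin 3 // (![false, false, true] : Fin 3 → Bool) i = a} F) false).comp (reindexGL e).toMonoidHom) : Representation ℂ (GL (Fin 2) F) ↥W₂.toSubmodule)) y) =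
      Representation.Coinvariants.mk (restrictUnipotentGL F (id : Fin 2 → Fin 2) ((normalizedJacquetGL F (![false, false, true] : Fin 3 → Bool) V).comp ((MonoidHom.mulSingle (fun a : Bool => GL {i : Fin 3 // (![false, false, true] : Fin 3 → Bool) i = a} F) false).comp (reindexGL e).toMonoidHom) : Representation ℂ (GL (Fin 2) F) (restrictUnipotentGL F (![false, false, true] : Fin 3 → Bool) V).Coinvariants)) (y : (restrictUnipotentGL F (![false, false, true] : Fin 3 → Bool) V).Coinvariants) := jacquetGLMap_mk (F := F) (c := (id : Fin 2 → Fin 2)) f y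
  constructor
  · intro h
    have e2 : jacquetGLMap F (id : Fin 2 → Fin 2) f (Representation.Coinvariants.mk (restrictUnipotentGL F (id : Fin 2 → Fin 2) (W₂.toRepresentation.comp ((MonoidHom.mulSingle (fun a : Bool => GL {i : Fin 3 // (![false, false, true] : Fin 3 → Bool) i = a} F) false).comp (reindexGL e).toMonoidHom) : Representation ℂ (GL (Fin 2) F) ↥W₂.toSubmodule)) y) = 0 :=
      (congrArg (jacquetGLMap F (id : Fin 2 → Fin 2) f) ((Coinvariants.mk_eq_zero _).2 h)).trans (map_zero _)
    exact LinearMap.mem_ker.1 ((ker_stagesMap_eq e he V).ge ((Coinvariants.mk_eq_zero _).1 (hmk.symm.trans e2)))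
  · intro h
    have h2 : (y : (restrictUnipotentGL F (![false, false, true] : Fin 3 → Bool) V).Coinvariants) ∈ (Representation.Coinvariants.ker (restrictUnipotentGL F (id : Fin 2 → Fin 2) ((normalizedJacquetGL F (![false, false, true] : Fin 3 → Bool) V).comp ((MonoidHom.mulSingle (fun a : Bool => GL {i : Fin 3 // (![false, false, true] : Fin 3 → Bool) i = a} F) false).comp (reindexGL e).toMonoidHom) : Representation ℂ (GL (Fin 2) F) (restrictUnipotentGL F (![false, false, true] : Fin 3 → Bool) V).Coinvariants))) := (ker_stagesMap_eq e he V).le (LinearMap.mem_ker.2 h)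
    have e1 := (hmk.trans ((Coinvariants.mk_eq_zero _).2 h2)).trans (map_zero (jacquetGLMap F (id : Fin 2 → Fin 2) f)).symm
    exact (Coinvariants.mk_eq_zero _).1 (hinj e1)

omit [ValuativeRel F] [TopologicalSpace F] [IsNonarchimedeanLocalField F] in
/-- In `W₂ ∕ W₁`: `[w] = [w − w₁]` for `w₁ ∈ W₁`. [folklore] -/
theorem quotient_mk_eq_mk_sub {G : Type} [Group G] {Y : Type*} [AddCommGroup Y] [Module ℂ Y] {τ : Representation ℂ G Y} (W₁ W₂ : Subrepresentation τ) (h12 : W₁ ≤ W₂)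
    (w : ↥W₂.toSubmodule) (w₁ : Y) (hw₁ : w₁ ∈ W₁.toSubmodule) :
    (Submodule.Quotient.mk w : ↥W₂.toSubmodule ⧸ (Subrepresentation.comapSubtype τ W₂ W₁).toSubmodule) =
      Submodule.Quotient.mk (⟨(w : Y) - w₁, W₂.toSubmodule.sub_mem w.2 (h12 hw₁)⟩ : ↥W₂.toSubmodule) := by
  rw [eq_comm, Submodule.Quotient.eq]
  show ((⟨(w : Y) - w₁, W₂.toSubmodule.sub_mem w.2 (h12 hw₁)⟩ - w : ↥W₂.toSubmodule) : Y) ∈ W₁.toSubmodule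
  rw [Submodule.coe_sub, Subtype.coe_mk, sub_sub_cancel_left]
  exact W₁.toSubmodule.neg_mem hw₁

include he in
/-- The injectivity core of §3: if `w ∈ W₂` has `p w ∈ p(W₁)`, then the class of `w` in the `U₂`-coinvariants of `(W₂ ∕ W₁) ∘ ι` vanishes (`w − w₁ ∈ W₂ ∩ ker p` lies in the
`U₂`-kernel of `W₂ ∘ ι` by ★ `mem_coinvariantsKer_subrepresentation_iff`, and `W₂ ∘ ι → (W₂∕W₁) ∘ ι` is `GL₂`-equivariant). [cite: BernsteinZelevinsky1977, Prop. 1.9 (a)] -/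
theorem coinvariants_mk_quotient_mk_eq_zero (hW : (normalizedJacquetGL F (![false, false, true] : Fin 3 → Bool) V).IsSmooth) (W₁ W₂ : Subrepresentation (normalizedJacquetGL F (![false, false, true] : Fin 3 → Bool) V)) (h12 : W₁ ≤ W₂) (w : ↥W₂.toSubmodule)
    (hw : (Representation.Coinvariants.lift (restrictUnipotentGL F (![false, false, true] : Fin 3 → Bool) V) (Representation.Coinvariants.mk (restrictUnipotentGL F (id : Fin 3 → Fin 3) V)) (K2E3GL3JacquetInStagesBorel.mk_comp_restrictUnipotentGL_twoOne_eq V)) (w : (restrictUnipotentGL F (![false, false, true] : Fin 3 → Bool) V).Coinvariants) ∈ W₁.toSubmodule.map (Representation.Coinvariants.lift (restrictUnipotentGL F (![false, false, true] : Fin 3 → Bool) V) (Representation.Coinvariants.mk (restrictUnipotentGL F (id : Fin 3 → Fin 3) V)) (K2E3GL3JacquetInStagesBorel.mk_comp_restrictUnipotentGL_twoOne_eq V))) :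
    Representation.Coinvariants.mk (restrictUnipotentGL F (id : Fin 2 → Fin 2) ((Subrepresentation.comapSubtype (normalizedJacquetGL F (![false, false, true] : Fin 3 → Bool) V) W₂ W₁).quotientRep.comp ((MonoidHom.mulSingle (fun a : Bool => GL {i : Fin 3 // (![false, false, true] : Fin 3 → Bool) i = a} F) false).comp (reindexGL e).toMonoidHom) : Representation ℂ (GL (Fin 2) F) (↥W₂.toSubmodule ⧸ (Subrepresentation.comapSubtype (normalizedJacquetGL F (![false, false, true] : Fin 3 → Bool) V) W₂ W₁).toSubmodule))) (Submodule.Quotient.mk w) = 0 := by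
  have hw' : ∃ w₁, w₁ ∈ W₁.toSubmodule ∧ (Representation.Coinvariants.lift (restrictUnipotentGL F (![false, false, true] : Fin 3 → Bool) V) (Representation.Coinvariants.mk (restrictUnipotentGL F (id : Fin 3 → Fin 3) V)) (K2E3GL3JacquetInStagesBorel.mk_comp_restrictUnipotentGL_twoOne_eq V)) w₁ = (Representation.Coinvariants.lift (restrictUnipotentGL F (![false, false, true] : Fin 3 → Bool) V) (Representation.Coinvariants.mk (restrictUnipotentGL F (id : Fin 3 → Fin 3) V)) (K2E3GL3JacquetInStagesBorel.mk_comp_restrictUnipotentGL_twoOne_eq V)) (w : (restrictUnipotentGL F (![false, false, true] : Fin 3 → Bool) V).Coinvariants) := Submodule.mem_map.1 hw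
  obtain ⟨w₁, hw₁, hpw⟩ := hw'
  -- `w - w₁ ∈ W₂ ∩ ker p` is in the `U₂`-kernel of `W₂ ∘ ι`
  have hy : (⟨(w : (restrictUnipotentGL F (![false, false, true] : Fin 3 → Bool) V).Coinvariants) - w₁, W₂.toSubmodule.sub_mem w.2 (h12 hw₁)⟩ : ↥W₂.toSubmodule) ∈
      Representation.Coinvariants.ker (restrictUnipotentGL F (id : Fin 2 → Fin 2) (W₂.toRepresentation.comp ((MonoidHom.mulSingle (fun a : Bool => GL {i : Fin 3 // (![false, false, true] : Fin 3 → Bool) i = a} F) false).comp (reindexGL e).toMonoidHom) : Representation ℂ (GL (Fin 2) F) ↥W₂.toSubmodule)) := by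
    rw [mem_coinvariantsKer_subrepresentation_iff e he V hW]
    show (Representation.Coinvariants.lift (restrictUnipotentGL F (![false, false, true] : Fin 3 → Bool) V) (Representation.Coinvariants.mk (restrictUnipotentGL F (id : Fin 3 → Fin 3) V)) (K2E3GL3JacquetInStagesBorel.mk_comp_restrictUnipotentGL_twoOne_eq V)) ((w : (restrictUnipotentGL F (![false, false, true] : Fin 3 → Bool) V).Coinvariants) - w₁) = 0
    rw [map_sub, hpw, sub_self]
  -- the quotient map `W₂∘ι → (W₂∕W₁)∘ι` is `GL₂`-equivariant, so it maps `U₂`-kernels to `U₂`-kernels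
  let fq : Representation.IntertwiningMap (restrictUnipotentGL F (id : Fin 2 → Fin 2) (W₂.toRepresentation.comp ((MonoidHom.mulSingle (fun a : Bool => GL {i : Fin 3 // (![false, false, true] : Fin 3 → Bool) i = a} F) false).comp (reindexGL e).toMonoidHom) : Representation ℂ (GL (Fin 2) F) ↥W₂.toSubmodule)) (restrictUnipotentGL F (id : Fin 2 → Fin 2) ((Subrepresentation.comapSubtype (normalizedJacquetGL F (![false, false, true] : Fin 3 → Bool) V) W₂ W₁).quotientRep.comp ((MonoidHom.mulSingle (fun a : Bool => GL {i : Fin 3 // (![false, false, true] : Fin 3 → Bool) i = a} F) false).comp (reindexGL e).toMonoidHom) : Representation ℂ (GL (Fin 2) F) (↥W₂.toSubmodule ⧸ (Subrepresentation.comapSubtype (normalizedJacquetGL F (![false, false, true] : Fin 3 → Bool) V) W₂ W₁).toSubmodule))) :=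
    { toLinearMap := (Subrepresentation.comapSubtype (normalizedJacquetGL F (![false, false, true] : Fin 3 → Bool) V) W₂ W₁).toSubmodule.mkQ, isIntertwining' := fun g => LinearMap.ext fun v => rfl }
  exact (congrArg (Representation.Coinvariants.mk (restrictUnipotentGL F (id : Fin 2 → Fin 2) ((Subrepresentation.comapSubtype (normalizedJacquetGL F (![false, false, true] : Fin 3 → Bool) V) W₂ W₁).quotientRep.comp ((MonoidHom.mulSingle (fun a : Bool => GL {i : Fin 3 // (![false, false, true] : Fin 3 → Bool) i = a} F) false).comp (reindexGL e).toMonoidHom) : Representation ℂ (GL (Fin 2) F) (↥W₂.toSubmodule ⧸ (Subrepresentation.comapSubtype (normalizedJacquetGL F (![false, false, true] : Fin 3 → Bool) V) W₂ W₁).toSubmodule)))) (quotient_mk_eq_mk_sub W₁ W₂ h12 w w₁ hw₁)).trans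
    ((Coinvariants.map_mk fq (⟨(w : (restrictUnipotentGL F (![false, false, true] : Fin 3 → Bool) V).Coinvariants) - w₁, W₂.toSubmodule.sub_mem w.2 (h12 hw₁)⟩ : ↥W₂.toSubmodule)).symm.trans
      ((congrArg (Coinvariants.map _ _ fq) ((Coinvariants.mk_eq_zero _).2 hy)).trans (map_zero _)))

set_option maxHeartbeats 400000 in
include he in
/-- **THE `U₂`-COINVARIANTS OF A SUBQUOTIENT `(W₂ ∕ W₁) ∘ ι` ARE `p(W₂) ∕ p(W₁)`**: for `M`-subrepresentations `W₁ ≤ W₂` of `r_Q V` there is a linear isomorphism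
`Θ : r_{B₂}((W₂∕W₁)∘ι) ≃ p(W₂)∕p(W₁)` with `Θ [[w]] = [p w]` (well defined by §1 `⊇`; injective by left exactness §3 + §1 `⊆`; surjective trivially).  Its `T`-equivariance is
read off ★ `stagesMap_normalizedJacquetGL_levi`. [cite: BernsteinZelevinsky1977, Prop. 1.9 (a), (c)] [cite: Zelevinsky1980, §1.2] -/
theorem exists_coinvariants_subquotient_equiv (hW : (normalizedJacquetGL F (![false, false, true] : Fin 3 → Bool) V).IsSmooth) (W₁ W₂ : Subrepresentation (normalizedJacquetGL F (![false, false, true] : Fin 3 → Bool) V)) (h12 : W₁ ≤ W₂) :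
    ∃ Θ : (restrictUnipotentGL F (id : Fin 2 → Fin 2) ((Subrepresentation.comapSubtype (normalizedJacquetGL F (![false, false, true] : Fin 3 → Bool) V) W₂ W₁).quotientRep.comp ((MonoidHom.mulSingle (fun a : Bool => GL {i : Fin 3 // (![false, false, true] : Fin 3 → Bool) i = a} F) false).comp (reindexGL e).toMonoidHom) : Representation ℂ (GL (Fin 2) F) (↥W₂.toSubmodule ⧸ (Subrepresentation.comapSubtype (normalizedJacquetGL F (![false, false, true] : Fin 3 → Bool) V) W₂ W₁).toSubmodule))).Coinvariants ≃ₗ[ℂ]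
        (↥(W₂.toSubmodule.map (Representation.Coinvariants.lift (restrictUnipotentGL F (![false, false, true] : Fin 3 → Bool) V) (Representation.Coinvariants.mk (restrictUnipotentGL F (id : Fin 3 → Fin 3) V)) (K2E3GL3JacquetInStagesBorel.mk_comp_restrictUnipotentGL_twoOne_eq V))) ⧸ Submodule.comap (W₂.toSubmodule.map (Representation.Coinvariants.lift (restrictUnipotentGL F (![false, false, true] : Fin 3 → Bool) V) (Representation.Coinvariants.mk (restrictUnipotentGL F (id : Fin 3 → Fin 3) V)) (K2E3GL3JacquetInStagesBorel.mk_comp_restrictUnipotentGL_twoOne_eq V))).subtype (W₁.toSubmodule.map (Representation.Coinvariants.lift (restrictUnipotentGL F (![false, false, true] : Fin 3 → Bool) V) (Representation.Coinvariants.mk (restrictUnipotentGL F (id : Fin 3 → Fin 3) V)) (K2E3GL3JacquetInStagesBorel.mk_comp_restrictUnipotentGL_twoOne_eq V)))),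
      ∀ w : ↥W₂.toSubmodule, Θ (Representation.Coinvariants.mk (restrictUnipotentGL F (id : Fin 2 → Fin 2) ((Subrepresentation.comapSubtype (normalizedJacquetGL F (![false, false, true] : Fin 3 → Bool) V) W₂ W₁).quotientRep.comp ((MonoidHom.mulSingle (fun a : Bool => GL {i : Fin 3 // (![false, false, true] : Fin 3 → Bool) i = a} F) false).comp (reindexGL e).toMonoidHom) : Representation ℂ (GL (Fin 2) F) (↥W₂.toSubmodule ⧸ (Subrepresentation.comapSubtype (normalizedJacquetGL F (![false, false, true] : Fin 3 → Bool) V) W₂ W₁).toSubmodule))) (Submodule.Quotient.mk w)) =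
        Submodule.Quotient.mk ⟨(Representation.Coinvariants.lift (restrictUnipotentGL F (![false, false, true] : Fin 3 → Bool) V) (Representation.Coinvariants.mk (restrictUnipotentGL F (id : Fin 3 → Fin 3) V)) (K2E3GL3JacquetInStagesBorel.mk_comp_restrictUnipotentGL_twoOne_eq V)) (w : (restrictUnipotentGL F (![false, false, true] : Fin 3 → Bool) V).Coinvariants), Submodule.mem_map_of_mem w.2⟩ := by
  -- the map on `W₂`
  let g₀ : ↥W₂.toSubmodule →ₗ[ℂ] (↥(W₂.toSubmodule.map (Representation.Coinvariants.lift (restrictUnipotentGL F (![false, false, true] : Fin 3 → Bool) V) (Representation.Coinvariants.mk (restrictUnipotentGL F (id : Fin 3 → Fin 3) V)) (K2E3GL3JacquetInStagesBorel.mk_comp_restrictUnipotentGL_twoOne_eq V))) ⧸ Submodule.comap (W₂.toSubmodule.map (Representation.Coinvariants.lift (restrictUnipotentGL F (![false, false, true] : Fin 3 → Bool) V) (Representation.Coinvariants.mk (restrictUnipotentGL F (id : Fin 3 → Fin 3) V)) (K2E3GL3JacquetInStagesBorel.mk_comp_restrictUnipotentGL_twoOne_eq V))).subtype (W₁.toSubmodule.map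 (Representation.Coinvariants.lift (restrictUnipotentGL F (![false, false, true] : Fin 3 → Bool) V) (Representation.Coinvariants.mk (restrictUnipotentGL F (id : Fin 3 → Fin 3) V)) (K2E3GL3JacquetInStagesBorel.mk_comp_restrictUnipotentGL_twoOne_eq V)))) :=
    (Submodule.mkQ _).comp (LinearMap.codRestrict (W₂.toSubmodule.map (Representation.Coinvariants.lift (restrictUnipotentGL F (![false, false, true] : Fin 3 → Bool) V) (Representation.Coinvariants.mk (restrictUnipotentGL F (id : Fin 3 → Fin 3) V)) (K2E3GL3JacquetInStagesBorel.mk_comp_restrictUnipotentGL_twoOne_eq V))) ((Representation.Coinvariants.lift (restrictUnipotentGL F (![false, false, true] : Fin 3 → Bool) V) (Representation.Coinvariants.mk (restrictUnipotentGL F (id : Fin 3 → Fin 3) V)) (K2E3GL3JacquetInStagesBorel.mk_comp_restrictUnipotentGL_twoOne_eq V)).domRestrict W₂.toSubmodule) fun w => Submodule.mem_map_of_mem w.2)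
  have hg₀ : ∀ w : ↥W₂.toSubmodule, g₀ w = Submodule.Quotient.mk ⟨(Representation.Coinvariants.lift (restrictUnipotentGL F (![false, false, true] : Fin 3 → Bool) V) (Representation.Coinvariants.mk (restrictUnipotentGL F (id : Fin 3 → Fin 3) V)) (K2E3GL3JacquetInStagesBorel.mk_comp_restrictUnipotentGL_twoOne_eq V)) (w : (restrictUnipotentGL F (![false, false, true] : Fin 3 → Bool) V).Coinvariants), Submodule.mem_map_of_mem w.2⟩ := fun w => rfl
  have hg₀zero : ∀ w : ↥W₂.toSubmodule, g₀ w = 0 ↔ (Representation.Coinvariants.lift (restrictUnipotentGL F (![false, false, true] : Fin 3 → Bool) V) (Representation.Coinvariants.mk (restrictUnipotentGL F (id : Fin 3 → Fin 3) V)) (K2E3GL3JacquetInStagesBorel.mk_comp_restrictUnipotentGL_twoOne_eq V)) (w : (restrictUnipotentGL F (![false, false, true] : Fin 3 → Bool) V).Coinvariants) ∈ W₁.toSubmodule.map (Representation.Coinvariants.lift (restrictUnipotentGL F (![false, false, true] : Fin 3 → Bool) V) (Representation.Coinvariants.mk (restrictUnipotentGL F (id : Fin 3 → Fin 3) V)) (K2E3GL3JacquetInStagesBorel.mk_comp_restrictUnipotentGL_twoOne_eq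 V)) := fun w => by
    rw [hg₀, Submodule.Quotient.mk_eq_zero, Submodule.mem_comap, Submodule.subtype_apply]
  -- descend to `W₂ ∕ W₁`
  have hker₁ : (Subrepresentation.comapSubtype (normalizedJacquetGL F (![false, false, true] : Fin 3 → Bool) V) W₂ W₁).toSubmodule ≤ LinearMap.ker g₀ := fun w hw => by
    rw [LinearMap.mem_ker, hg₀zero]
    exact Submodule.mem_map_of_mem hw
  let g₁ := (Subrepresentation.comapSubtype (normalizedJacquetGL F (![false, false, true] : Fin 3 → Bool) V) W₂ W₁).toSubmodule.liftQ g₀ hker₁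
  have hg₁ : ∀ w : ↥W₂.toSubmodule, g₁ (Submodule.Quotient.mk w) = g₀ w := fun w => rfl
  -- `ι(U₂)` acts trivially modulo `ker p` (§1), so `g₀` is `U₂`-invariant
  have key : ∀ (u : ↥(unipotentRadicalP F (id : Fin 2 → Fin 2))) (w : ↥W₂.toSubmodule),
      g₀ (W₂.toRepresentation (((MonoidHom.mulSingle (fun a : Bool => GL {i : Fin 3 // (![false, false, true] : Fin 3 → Bool) i = a} F) false).comp (reindexGL e).toMonoidHom) ((u : ↥(standardParabolicGL F (id : Fin 2 → Fin 2))) : GL (Fin 2) F)) w) = g₀ w := by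
    intro u w
    have hP : (Representation.Coinvariants.lift (restrictUnipotentGL F (![false, false, true] : Fin 3 → Bool) V) (Representation.Coinvariants.mk (restrictUnipotentGL F (id : Fin 3 → Fin 3) V)) (K2E3GL3JacquetInStagesBorel.mk_comp_restrictUnipotentGL_twoOne_eq V)) ((W₂.toRepresentation (((MonoidHom.mulSingle (fun a : Bool => GL {i : Fin 3 // (![false, false, true] : Fin 3 → Bool) i = a} F) false).comp (reindexGL e).toMonoidHom) ((u : ↥(standardParabolicGL F (id : Fin 2 → Fin 2))) : GL (Fin 2) F)) w : ↥W₂.toSubmodule) : (restrictUnipotentGL F (![false, false, true] : Fin 3 → Bool) V).Coinvariants) =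
        (Representation.Coinvariants.lift (restrictUnipotentGL F (![false, false, true] : Fin 3 → Bool) V) (Representation.Coinvariants.mk (restrictUnipotentGL F (id : Fin 3 → Fin 3) V)) (K2E3GL3JacquetInStagesBorel.mk_comp_restrictUnipotentGL_twoOne_eq V)) (w : (restrictUnipotentGL F (![false, false, true] : Fin 3 → Bool) V).Coinvariants) := by
      rw [← sub_eq_zero, ← map_sub]
      exact LinearMap.mem_ker.1 ((ker_stagesMap_eq e he V).ge (Coinvariants.sub_mem_ker (ρ := restrictUnipotentGL F (id : Fin 2 → Fin 2) ((normalizedJacquetGL F (![false, false, true] : Fin 3 → Bool) V).comp ((MonoidHom.mulSingle (fun a : Bool => GL {i : Fin 3 // (![false, false, true] : Fin 3 → Bool) i = a} F) false).comp (reindexGL e).toMonoidHom) : Representation ℂ (GL (Fin 2) F) (restrictUnipotentGL F (![false, false, true] : Fin 3 → Bool) V).Coinvariants)) u _))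
    exact (hg₀ _).trans ((congrArg (Submodule.Quotient.mk
      (p := Submodule.comap (W₂.toSubmodule.map (Representation.Coinvariants.lift (restrictUnipotentGL F (![false, false, true] : Fin 3 → Bool) V) (Representation.Coinvariants.mk (restrictUnipotentGL F (id : Fin 3 → Fin 3) V)) (K2E3GL3JacquetInStagesBorel.mk_comp_restrictUnipotentGL_twoOne_eq V))).subtype (W₁.toSubmodule.map (Representation.Coinvariants.lift (restrictUnipotentGL F (![false, false, true] : Fin 3 → Bool) V) (Representation.Coinvariants.mk (restrictUnipotentGL F (id : Fin 3 → Fin 3) V)) (K2E3GL3JacquetInStagesBorel.mk_comp_restrictUnipotentGL_twoOne_eq V))))) (Subtype.ext hP)).trans (hg₀ w).symm)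
  -- descend to the `U₂`-coinvariants
  have hinv : ∀ u : ↥(unipotentRadicalP F (id : Fin 2 → Fin 2)), g₁ ∘ₗ (restrictUnipotentGL F (id : Fin 2 → Fin 2) ((Subrepresentation.comapSubtype (normalizedJacquetGL F (![false, false, true] : Fin 3 → Bool) V) W₂ W₁).quotientRep.comp ((MonoidHom.mulSingle (fun a : Bool => GL {i : Fin 3 // (![false, false, true] : Fin 3 → Bool) i = a} F) false).comp (reindexGL e).toMonoidHom) : Representation ℂ (GL (Fin 2) F) (↥W₂.toSubmodule ⧸ (Subrepresentation.comapSubtype (normalizedJacquetGL F (![false, false, true] : Fin 3 → Bool) V) W₂ W₁).toSubmodule))) u = g₁ := by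
    intro u
    refine Submodule.linearMap_qext _ (LinearMap.ext fun w => ?_)
    exact (hg₁ _).trans ((key u w).trans (hg₁ w).symm)
  let Θ := Representation.Coinvariants.lift _ g₁ hinv
  have hΘ : ∀ w : ↥W₂.toSubmodule, Θ (Representation.Coinvariants.mk (restrictUnipotentGL F (id : Fin 2 → Fin 2) ((Subrepresentation.comapSubtype (normalizedJacquetGL F (![false, false, true] : Fin 3 → Bool) V) W₂ W₁).quotientRep.comp ((MonoidHom.mulSingle (fun a : Bool => GL {i : Fin 3 // (![false, false, true] : Fin 3 → Bool) i = a} F) false).comp (reindexGL e).toMonoidHom) : Representation ℂ (GL (Fin 2) F) (↥W₂.toSubmodule ⧸ (Subrepresentation.comapSubtype (normalizedJacquetGL F (![false, false, true] : Fin 3 → Bool) V) W₂ W₁).toSubmodule))) (Submodule.Quotient.mk w)) =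
      Submodule.Quotient.mk ⟨(Representation.Coinvariants.lift (restrictUnipotentGL F (![false, false, true] : Fin 3 → Bool) V) (Representation.Coinvariants.mk (restrictUnipotentGL F (id : Fin 3 → Fin 3) V)) (K2E3GL3JacquetInStagesBorel.mk_comp_restrictUnipotentGL_twoOne_eq V)) (w : (restrictUnipotentGL F (![false, false, true] : Fin 3 → Bool) V).Coinvariants), Submodule.mem_map_of_mem w.2⟩ := fun w => rfl
  clear_value Θ
  have hsurj : Function.Surjective Θ := fun z => Submodule.Quotient.induction_on _ z fun a => (Submodule.mem_map.1 a.2).elim fun w hw =>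
    ⟨Representation.Coinvariants.mk (restrictUnipotentGL F (id : Fin 2 → Fin 2) ((Subrepresentation.comapSubtype (normalizedJacquetGL F (![false, false, true] : Fin 3 → Bool) V) W₂ W₁).quotientRep.comp ((MonoidHom.mulSingle (fun a : Bool => GL {i : Fin 3 // (![false, false, true] : Fin 3 → Bool) i = a} F) false).comp (reindexGL e).toMonoidHom) : Representation ℂ (GL (Fin 2) F) (↥W₂.toSubmodule ⧸ (Subrepresentation.comapSubtype (normalizedJacquetGL F (![false, false, true] : Fin 3 → Bool) V) W₂ W₁).toSubmodule))) (Submodule.Quotient.mk ⟨w, hw.1⟩),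
      (hΘ ⟨w, hw.1⟩).trans (congrArg (Submodule.Quotient.mk (p := Submodule.comap (W₂.toSubmodule.map (Representation.Coinvariants.lift (restrictUnipotentGL F (![false, false, true] : Fin 3 → Bool) V) (Representation.Coinvariants.mk (restrictUnipotentGL F (id : Fin 3 → Fin 3) V)) (K2E3GL3JacquetInStagesBorel.mk_comp_restrictUnipotentGL_twoOne_eq V))).subtype (W₁.toSubmodule.map (Representation.Coinvariants.lift (restrictUnipotentGL F (![false, false, true] : Fin 3 → Bool) V) (Representation.Coinvariants.mk (restrictUnipotentGL F (id : Fin 3 → Fin 3) V)) (K2E3GL3JacquetInStagesBorel.mk_comp_restrictUnipotentGL_twoOne_eq V)))))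
        (Subtype.ext hw.2))⟩
  have hinjΘ : Function.Injective Θ := by
    rw [injective_iff_map_eq_zero]
    intro z
    induction z using Representation.Coinvariants.induction_on with | h v => ?_
    induction v using Submodule.Quotient.induction_on with | H w => ?_
    intro hz
    have hz' : (⟨(Representation.Coinvariants.lift (restrictUnipotentGL F (![false, false, true] : Fin 3 → Bool) V) (Representation.Coinvariants.mk (restrictUnipotentGL F (id : Fin 3 → Fin 3) V)) (K2E3GL3JacquetInStagesBorel.mk_comp_restrictUnipotentGL_twoOne_eq V)) (w : (restrictUnipotentGL F (![false, false, true] : Fin 3 → Bool) V).Coinvariants), Submodule.mem_map_of_mem w.2⟩ : ↥(W₂.toSubmodule.map (Representation.Coinvariants.lift (restrictUnipotentGL F (![false, false, true] : Fin 3 → Bool) V) (Representation.Coinvariants.mk (restrictUnipotentGL F (id : Fin 3 → Fin 3) V)) (K2E3GL3JacquetInStagesBorel.mk_comp_restrictUnipotentGL_twoOne_eq V)))) ∈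
        Submodule.comap (W₂.toSubmodule.map (Representation.Coinvariants.lift (restrictUnipotentGL F (![false, false, true] : Fin 3 → Bool) V) (Representation.Coinvariants.mk (restrictUnipotentGL F (id : Fin 3 → Fin 3) V)) (K2E3GL3JacquetInStagesBorel.mk_comp_restrictUnipotentGL_twoOne_eq V))).subtype (W₁.toSubmodule.map (Representation.Coinvariants.lift (restrictUnipotentGL F (![false, false, true] : Fin 3 → Bool) V) (Representation.Coinvariants.mk (restrictUnipotentGL F (id : Fin 3 → Fin 3) V)) (K2E3GL3JacquetInStagesBorel.mk_comp_restrictUnipotentGL_twoOne_eq V))) := (Submodule.Quotient.mk_eq_zero _).1 ((hΘ w).symm.trans hz)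
    exact coinvariants_mk_quotient_mk_eq_zero e he V hW W₁ W₂ h12 w hz'
  exact ⟨LinearEquiv.ofBijective Θ ⟨hinjΘ, hsurj⟩, hΘ⟩

end Subquotient

end Summit.HodgeConjecture.HodgeConjecture.Cruxes.H413.K2E3GL3JacquetInStagesBorel

end
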